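import Mathlib
import HarnessLib
import Literature.Analysis.FluidPDE.LocalTypeIBlowup.SingularVertexZoomSeq
import Literature.Analysis.FluidPDE.SereginSverakPressureLocalTypeI
import Literature.Analysis.FluidPDE.LerayHopfNSRescale
import Literature.Analysis.FluidPDE.SelfSimilarProofs
import Literature.Analysis.FluidPDE.NSViscosityRescaling
import Literature.Analysis.FluidPDE.LocalTypeIScaling
import Literature.Analysis.FluidPDE.Seregin2020AncientLimit
import Summits.NavierStokesRegularity.NavierStokesRegularity.Theorems.OneTimeDoorSchema
import Summits.NavierStokesRegularity.NavierStokesRegularity.Theorems.StableStrataDoorClassZoom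
import Summits.NavierStokesRegularity.NavierStokesRegularity.Theorems.StableStrataDoorSingularProfileFloor
import Summits.NavierStokesRegularity.NavierStokesRegularity.Theorems.LocalSineTubeDoorLocalPointZoomSlices

/-!
# StableStrataDoorAcrossSolutions — **I1⋆ `OneTimeDoorSchema.LocalPointZoomAcrossSolutionsM` PROVED**: the local point zoom
# ACROSS solutions of one class (nsreg-p1 g23 `r27/OneTimeSchema.lean` v2 5300b96bcafb33bf §1; DIRECTOR-NS #100 (2))

`localPointZoomAcrossSolutionsM_holds`: for every viscosity `ν` and local Type-I bound `M` there is a floor constant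
`c = c(ν, M) > 0` such that for every class `(T, ρ, E₀)` and every sequence of classical Leray–Hopf solutions `uₙ` of the class
(life span `T`, initial kinetic energy `≤ E₀`, space–time local Type I(`M`) at `(xₙ, T)` on the cylinder of radius `ρ`, NOT backward
bounded at `(xₙ, T)`) and prescribed times `tₙ → T⁻`, a subsequence of the parabolic zooms of `uₙ` about `(xₙ, T)` at the scales
`λₙ² = ν(T − tₙ)` converges pointwise on `s < −1/4` to ONE door-class profile with the envelope `(M/ν)/(‖y‖+√(−s))` and Seregin's
`L³`-floor `c` at EVERY scale.

PROOF.  (1) `StableStrataDoorClassZoom.classZoom_typeIBound_le`: the viscosity-normalising zooms `vₙ` of the `uₙ` about `(xₙ, T)`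
(ONE radius `R(ν, T, ρ)`) are suitable in the unit ball with the rate `M'/√(−s)` and a CLASS-UNIFORM local Type-I level
`𝐈(Q(0,1/2)) ≤ B(ν, M, T, ρ, E₀)`; each is backward-singular at the origin (`SereginSverak2002.isBackwardBoundedAt_of_zoom`).
(2) `Literature…LocalTypeIBlowup.exists_typeIAncientMild_zoomLimit_seq` (Barker–Prange zoom at prescribed vertices and
scales for a SEQUENCE of solutions, on the engine `local_typeI_compactness_singular` + persistence of singularities): along a
subsequence the zooms of the `vₙ` at the scales `½·√(ν(T−tₙ))/R` converge in `L³_loc` and pointwise on `s < −1` to a field `U`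
of the class `IsTypeIAncientMild M' U`, backward-singular at `0`.  (3) The space–time envelope of the `uₙ` passes to `U` a.e.
along the `L³_loc` limit and then everywhere by continuity; the door class is that of `U`; the `L³`-floor of the limit is the
tree's I1b `StableStrataDoorSingularProfileFloor.singularProfileFloor_holds` (ε-regularity under Type I in velocity terms —
no floor needs to be transported from the `uₙ`).  (4) The profile of the statement is the `2`-rescaling `V = nsRescale 2 U`
(so that physical time `t_{φ j}` is profile time `−1`), on which the window `s < −1` becomes `s < −1/4`.

Door family of LADDER-NS N0 (`--supports stmt-NavierStokesRegularity-0056`; nsreg-p6 g15); payoff = p1 §5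
`OneTimeDoorSchema.uniformOneTimeDoorAt_of_liouville` (every S26-schema door becomes a class-uniform ONE-TIME door).
WHAT THIS IS NOT: not NS regularity (Clay A); compactness INSIDE the Type-I class (`ε`, lateness by compactness); no route, no item.
-/

noncomputable section

set_option linter.dupNamespace false

namespace Summit.NavierStokesRegularity.NavierStokesRegularity.Theorems.StableStrataDoorAcrossSolutions

open MeasureTheory Set Function Filter Topology TopologicalSpace Metric
open Literature.Analysis Literature.Analysis.FluidPDE
open Summit.NavierStokesRegularity.NavierStokesRegularity.Theorems
open Summit.NavierStokesRegularity.NavierStokesRegularity.Theorems.StableStrataDoorOneSliceDefs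
open Summit.NavierStokesRegularity.NavierStokesRegularity.Theorems.ZoomReturnDoorDefs
open Summit.NavierStokesRegularity.NavierStokesRegularity.Theorems.OneTimeDoorSchema
open Summit.NavierStokesRegularity.NavierStokesRegularity.Theorems.LocalSineTubeDoorLocalPointZoomSlices
open scoped NNReal ENNReal

/-! ### A measure-theoretic tool -/

/-- A pointwise majorant valid along the tail of an `L³`-convergent sequence holds a.e. for the limit. -/
theorem ae_norm_le_of_tendsto_eLpNorm_three {Q₀ : Set (ℝ × EuclideanSpace ℝ (Fin 3))} (hQ₀ : MeasurableSet Q₀)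
    {W : ℕ → ℝ → EuclideanSpace ℝ (Fin 3) → EuclideanSpace ℝ (Fin 3)}
    {U : ℝ → EuclideanSpace ℝ (Fin 3) → EuclideanSpace ℝ (Fin 3)} {g : ℝ × EuclideanSpace ℝ (Fin 3) → ℝ}
    (hW : ∀ k, AEStronglyMeasurable (uncurry (W k)) (volume.restrict Q₀))
    (hU : AEStronglyMeasurable (uncurry U) (volume.restrict Q₀))
    (hconv : Tendsto (fun k => eLpNorm (uncurry (W k) - uncurry U) 3 (volume.restrict Q₀)) atTop (𝓝 0))
    (hbd : ∀ᶠ k in atTop, ∀ z ∈ Q₀, ‖uncurry (W k) z‖ ≤ g z) :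
    ∀ᵐ z ∂(volume.restrict Q₀), ‖uncurry U z‖ ≤ g z := by
  obtain ⟨φ, hφ, hae⟩ := (tendstoInMeasure_of_tendsto_eLpNorm (by norm_num) hW hU hconv).exists_seq_tendsto_ae
  have hbd' : ∀ᶠ i in atTop, ∀ z ∈ Q₀, ‖uncurry (W (φ i)) z‖ ≤ g z := hφ.tendsto_atTop.eventually hbd
  filter_upwards [hae, ae_restrict_mem hQ₀] with z hz hzQ
  exact le_of_tendsto hz.norm (hbd'.mono fun i hi => hi z hzQ)

/-! ### Two elementary facts about the zooms -/

/-- The parabolic dilation by `μ` with `μ r < 1` maps `Q(0, r)` into `Q(0, 1)`. -/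
theorem stAffine_mapsTo_unit {μ r : ℝ} (hμ : 0 < μ) (hμr : μ * r < 1) :
    MapsTo (stAffine (μ ^ 2) μ (0 : ℝ) (0 : EuclideanSpace ℝ (Fin 3)))
      (parabolicCylinder r (0 : ℝ × EuclideanSpace ℝ (Fin 3)))
      (parabolicCylinder 1 (0 : ℝ × EuclideanSpace ℝ (Fin 3))) := by
  intro w hw
  rw [SuitableCompactness.mem_parabolicCylinder_zero] at hw ⊢
  obtain ⟨⟨hw1, hw2⟩, hw3⟩ := hw
  simp only [stAffine_fst, stAffine_snd, zero_add]
  have hr : 0 ≤ r := le_of_lt (lt_of_le_of_lt (norm_nonneg _) hw3)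
  have hμr2 : μ ^ 2 * r ^ 2 < 1 := by nlinarith [mul_nonneg hμ.le hr]
  refine ⟨⟨by nlinarith [pow_pos hμ 2], mul_neg_of_pos_of_neg (pow_pos hμ 2) hw2⟩, ?_⟩
  rw [norm_smul, Real.norm_of_nonneg hμ.le]
  calc μ * ‖w.2‖ ≤ μ * r := by gcongr
    _ < 1 := hμr

/-- **The zooms see only the local Type-I cylinder**: the value of the `μ`-zoom of the viscosity-normalising zoom
`α u(T + β·, x₀ + R·)` at a point of `Q(0, r)` is bounded by the envelope `(M/ν)/(‖y‖ + √(−s))`, as soon as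
`μ² β r² < min T ρ²` and `μ R r < ρ`. -/
theorem norm_zoom_le_envelope {ν T ρ M R α β μ r : ℝ} (hν : 0 < ν) (hR : 0 < R) (hβ : 0 < β) (hμ : 0 < μ)
    (hαeq : α = R / ν) (hνβ : ν * β = R ^ 2)
    {u : ℝ → EuclideanSpace ℝ (Fin 3) → EuclideanSpace ℝ (Fin 3)} {x₀ : EuclideanSpace ℝ (Fin 3)}
    (hM' : ∀ s ∈ Ico 0 T, T - ρ ^ 2 < s → ∀ z ∈ ball x₀ ρ, ‖u s z‖ * (‖z - x₀‖ + Real.sqrt (ν * (T - s))) ≤ M)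
    (hk2 : μ ^ 2 * (β * r ^ 2) < min T (ρ ^ 2)) (hk3 : μ * (R * r) < ρ)
    {z : ℝ × EuclideanSpace ℝ (Fin 3)} (hz : z ∈ parabolicCylinder r (0 : ℝ × EuclideanSpace ℝ (Fin 3))) :
    ‖(μ * α) • u (T + β * (μ ^ 2 * z.1)) (x₀ + R • (μ • z.2))‖ ≤ M / ν / (‖z.2‖ + Real.sqrt (-z.1)) := by
  rw [SuitableCompactness.mem_parabolicCylinder_zero] at hz
  obtain ⟨⟨hz1, hz2⟩, hz3⟩ := hz
  have hs0 : 0 < -z.1 := by linarith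
  have hneg : β * (μ ^ 2 * (-z.1)) < min T (ρ ^ 2) := by
    calc β * (μ ^ 2 * (-z.1)) ≤ β * (μ ^ 2 * r ^ 2) := by gcongr; linarith
      _ = μ ^ 2 * (β * r ^ 2) := by ring
      _ < min T (ρ ^ 2) := hk2
  have ht₁I : T + β * (μ ^ 2 * z.1) ∈ Ico 0 T := by
    refine ⟨?_, ?_⟩
    · have := min_le_left T (ρ ^ 2); nlinarith
    · nlinarith [mul_pos hβ (mul_pos (pow_pos hμ 2) hs0)]
  have ht₁ρ : T - ρ ^ 2 < T + β * (μ ^ 2 * z.1) := by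
    have := min_le_right T (ρ ^ 2); nlinarith
  have hy₁ : x₀ + R • (μ • z.2) ∈ ball x₀ ρ := by
    rw [mem_ball, dist_eq_norm, add_sub_cancel_left, norm_smul, norm_smul, Real.norm_of_nonneg hR.le,
      Real.norm_of_nonneg hμ.le]
    calc R * (μ * ‖z.2‖) ≤ R * (μ * r) := by gcongr
      _ = μ * (R * r) := by ring
      _ < ρ := hk3
  have hb := hM' _ ht₁I ht₁ρ _ hy₁
  have hdist : ‖x₀ + R • (μ • z.2) - x₀‖ = R * μ * ‖z.2‖ := by
    rw [add_sub_cancel_left, norm_smul, norm_smul, Real.norm_of_nonneg hR.le, Real.norm_of_nonneg hμ.le, mul_assoc]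
  have hsq : Real.sqrt (ν * (T - (T + β * (μ ^ 2 * z.1)))) = R * μ * Real.sqrt (-z.1) := by
    have e : ν * (T - (T + β * (μ ^ 2 * z.1))) = (R * μ) ^ 2 * (-z.1) := by
      calc ν * (T - (T + β * (μ ^ 2 * z.1))) = (ν * β) * μ ^ 2 * (-z.1) := by ring
        _ = (R * μ) ^ 2 * (-z.1) := by rw [hνβ]; ring
    rw [e, Real.sqrt_mul (sq_nonneg _), Real.sqrt_sq (by positivity)]
  rw [hdist, hsq, ← mul_add] at hb
  have ha : 0 < ‖z.2‖ + Real.sqrt (-z.1) := by positivity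
  rw [norm_smul, Real.norm_of_nonneg (by rw [hαeq]; positivity), le_div_iff₀ ha, hαeq]
  calc μ * (R / ν) * ‖u (T + β * (μ ^ 2 * z.1)) (x₀ + R • (μ • z.2))‖ * (‖z.2‖ + Real.sqrt (-z.1))
      = (‖u (T + β * (μ ^ 2 * z.1)) (x₀ + R • (μ • z.2))‖ * (R * μ * (‖z.2‖ + Real.sqrt (-z.1)))) / ν := by
        field_simp
    _ ≤ M / ν := div_le_div_of_nonneg_right hb hν.le

/-! ### I1⋆ -/

/-- **I1⋆ · THE LOCAL POINT ZOOM ACROSS SOLUTIONS OF ONE CLASS — PROVED** (module docstring). -/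
theorem localPointZoomAcrossSolutionsM_holds : LocalPointZoomAcrossSolutionsM := by
  intro ν hν M
  -- ### the floor constant, BEFORE the class: I1b at the envelope level `max (M/ν) 1`
  obtain ⟨c, hc, hfloor⟩ :=
    StableStrataDoorSingularProfileFloor.singularProfileFloor_holds (max (M / ν) 1) (lt_max_of_lt_right one_pos)
  refine ⟨c, hc, fun T ρ E₀ hT hρ u p x t hcl hLH _ hE hM' hnb htT ht => ?_⟩
  -- ### the class zoom (radius and level fixed before the solutions)
  obtain ⟨R, α, β, B, hR, hα, hβ, hβeq, hαeq, hβT, hRρ, hβρ, hBtop, hzoom⟩ :=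
    StableStrataDoorClassZoom.classZoom_typeIBound_le hν hT hρ M E₀
  have hρR : 0 < ρ / R := div_pos hρ hR
  have h1ρR : (1 : ℝ) ≤ ρ / R := by rw [le_div_iff₀ hR, one_mul]; exact hRρ
  have hνβ : ν * β = R ^ 2 := by rw [hβeq]; field_simp
  -- the time-only rate of each solution
  have hM : ∀ n, ∀ s ∈ Ico 0 T, T - ρ ^ 2 < s → ∀ z ∈ ball (x n) ρ, ‖u n s z‖ * Real.sqrt (ν * (T - s)) ≤ M := by
    intro n s hs hlt z hz
    refine le_trans ?_ (hM' n s hs hlt z hz)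
    exact mul_le_mul_of_nonneg_left (le_add_of_nonneg_left (norm_nonneg _)) (norm_nonneg _)
  -- ### the zoomed pairs
  set q : ℕ → ℝ → EuclideanSpace ℝ (Fin 3) → ℝ :=
    fun n t' y => p n t' y - (p n t' 0 - normalisedPressure (u n t') 0) with hq
  set v : ℕ → ℝ → EuclideanSpace ℝ (Fin 3) → EuclideanSpace ℝ (Fin 3) := fun n => α • stPull β R T (x n) (u n) with hv
  set π : ℕ → ℝ → EuclideanSpace ℝ (Fin 3) → ℝ := fun n => α ^ 2 • stPull β R T (x n) (q n) with hπ
  set Gz : ℕ → ℝ → EuclideanSpace ℝ (Fin 3) → EuclideanSpace ℝ (Fin 3) →L[ℝ] EuclideanSpace ℝ (Fin 3) :=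
    fun n => (α * R) • stPull β R T (x n) (fun t' y => fderiv ℝ (u n t') y) with hGz
  have hz : ∀ n, IsSuitableWeakSolutionInBall 1 0 (v n) (π n) ∧
      HasWeakSpatialGradientOn (parabolicCylinderOpens 1 (0 : ℝ × EuclideanSpace ℝ (Fin 3))) (v n) (Gz n) ∧
      (∀ s ∈ Ioo (-1 : ℝ) 0, ∀ y ∈ ball (0 : EuclideanSpace ℝ (Fin 3)) (ρ / R),
        ‖v n s y‖ ≤ (α * max M 0 / Real.sqrt (ν * β)) / Real.sqrt (-s)) ∧
      typeIBound (parabolicCylinder (1 / 2) (0 : ℝ × EuclideanSpace ℝ (Fin 3))) (v n) (π n) (Gz n) ≤ B :=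
    fun n => hzoom (u n) (p n) (x n) (hcl n) (hLH n) (hE n) (hM n)
  set M' : ℝ := α * max M 0 / Real.sqrt (ν * β) with hM'def
  -- ### the inputs of the sequence zoom engine on `Q(0, 1/2)`
  have hhalf : (0 : ℝ) < 1 / 2 := by norm_num
  have hsub12 : parabolicCylinder (1 / 2) (0 : ℝ × EuclideanSpace ℝ (Fin 3)) ⊆
      parabolicCylinder 1 (0 : ℝ × EuclideanSpace ℝ (Fin 3)) :=
    SuitableCompactness.parabolicCylinder_zero_mono hhalf.le (by norm_num)
  have hball : ∀ n, IsSuitableWeakSolutionInBall (1 / 2) (0 : ℝ × EuclideanSpace ℝ (Fin 3)) (v n) (π n) :=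
    fun n => (hz n).1.of_subset_zero hhalf hsub12
  have hwg : ∀ n, HasWeakSpatialGradientOn (parabolicCylinderOpens (1 / 2) (0 : ℝ × EuclideanSpace ℝ (Fin 3)))
      (v n) (Gz n) := fun n => (hz n).2.1.mono fun w hw => hsub12 hw
  have hIn : ∀ n, typeIBound (parabolicCylinder (1 / 2) (0 : ℝ × EuclideanSpace ℝ (Fin 3))) (v n) (π n) (Gz n) ≤ B :=
    fun n => (hz n).2.2.2
  -- continuity of the zooms on `Q(0,1)`
  have hmap : ∀ n, ∀ w ∈ parabolicCylinder 1 (0 : ℝ × EuclideanSpace ℝ (Fin 3)),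
      ((T + β * w.1, x n + R • w.2) : ℝ × EuclideanSpace ℝ (Fin 3)) ∈ Ico 0 T ×ˢ (univ : Set (EuclideanSpace ℝ (Fin 3))) := by
    intro n w hw
    rw [SuitableCompactness.mem_parabolicCylinder_zero] at hw
    obtain ⟨⟨h1, h2⟩, -⟩ := hw
    refine ⟨⟨?_, ?_⟩, mem_univ _⟩
    · nlinarith [hβT, hβ]
    · nlinarith [hβ]
  have hcontv : ∀ n, ContinuousOn (uncurry (v n)) (parabolicCylinder 1 (0 : ℝ × EuclideanSpace ℝ (Fin 3))) := by
    intro n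
    have e : uncurry (v n) = fun w => α • (uncurry (u n) ∘ fun w : ℝ × EuclideanSpace ℝ (Fin 3) =>
        ((T + β * w.1, x n + R • w.2) : ℝ × EuclideanSpace ℝ (Fin 3))) w := by
      funext w; rfl
    rw [e]
    refine ContinuousOn.const_smul ((SereginSverak2002.continuousOn_uncurry (hcl n)).comp ?_ (hmap n)) α
    exact ((continuous_const.add (continuous_const.mul continuous_fst)).prodMk
      (continuous_const.add (continuous_snd.const_smul R))).continuousOn
  have hcont : ∀ n, ContinuousOn (uncurry (v n)) (parabolicCylinder (1 / 2) (0 : ℝ × EuclideanSpace ℝ (Fin 3))) :=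
    fun n => (hcontv n).mono hsub12
  -- the rate on `Q(0, 1/2)`
  have hrate : ∀ (n : ℕ) (t' : ℝ) (y : EuclideanSpace ℝ (Fin 3)),
      (t', y) ∈ parabolicCylinder (1 / 2) (0 : ℝ × EuclideanSpace ℝ (Fin 3)) →
        ‖v n t' y‖ ≤ M' / Real.sqrt ((0 : ℝ × EuclideanSpace ℝ (Fin 3)).1 - t') := by
    intro n t' y hw
    have hw1 := hsub12 hw
    rw [SuitableCompactness.mem_parabolicCylinder_zero] at hw1
    obtain ⟨⟨h1, h2⟩, h3⟩ := hw1
    have hy : y ∈ ball (0 : EuclideanSpace ℝ (Fin 3)) (ρ / R) := by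
      rw [mem_ball_zero_iff]
      exact lt_of_lt_of_le (by simpa using h3) h1ρR
    have h := (hz n).2.2.1 t' ⟨by simpa using h1, h2⟩ y hy
    simpa using h
  -- each zoom is backward-singular at the origin
  have hsing : ∀ n, IsBackwardSingularPoint (v n) (0 : ℝ × EuclideanSpace ℝ (Fin 3)) := by
    intro n r hr
    by_contra hfin
    have hfin' : eLpNorm (uncurry (v n)) ⊤
        (volume.restrict (parabolicCylinder (min r 1) (0 : ℝ × EuclideanSpace ℝ (Fin 3)))) < ⊤ := by
      refine lt_of_le_of_lt (eLpNorm_mono_measure _ (Measure.restrict_mono ?_ le_rfl))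
        (lt_top_iff_ne_top.2 hfin)
      exact SuitableCompactness.parabolicCylinder_zero_mono (le_min hr.le zero_le_one) (min_le_left _ _)
    exact hnb n (SereginSverak2002.isBackwardBoundedAt_of_zoom (hcl n) (x n) hR hα hβ hβT
      (lt_min hr one_pos) (min_le_right _ _) hfin')
  -- ### the scales `μₙ = √(ν (T − tₙ))/R → 0` and the engine at the scales `μₙ/2`
  set lam₀ : ℕ → ℝ := fun n => Real.sqrt (ν * (T - t n)) with hlam₀
  have hlam₀pos : ∀ n, 0 < lam₀ n := fun n => Real.sqrt_pos.2 (mul_pos hν (by linarith [htT n]))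
  have hlam₀0 : Tendsto lam₀ atTop (𝓝 0) := by
    have h1 : Tendsto (fun n => ν * (T - t n)) atTop (𝓝 (ν * (T - T))) :=
      (tendsto_const_nhds.sub ht).const_mul ν
    rw [sub_self, mul_zero] at h1
    simpa using h1.sqrt
  set μ : ℕ → ℝ := fun n => lam₀ n / R / 2 with hμ
  have hμpos : ∀ n, 0 < μ n := fun n => div_pos (div_pos (hlam₀pos n) hR) two_pos
  have hμ0 : Tendsto μ atTop (𝓝 0) := by
    simpa using (hlam₀0.div_const R).div_const 2
  obtain ⟨φ, hφ, U, P, H, hTI, hswU, hHU, hIU, hsingU, hL3, hpt, -⟩ :=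
    LocalTypeIBlowup.exists_typeIAncientMild_zoomLimit_seq (z₀ := fun _ => (0 : ℝ × EuclideanSpace ℝ (Fin 3)))
      hhalf hBtop.lt_top hball hwg hIn hcont hrate hsing hμpos hμ0
  -- ### the profile of the statement: `V = nsRescale 2 U`, scales `λⱼ = √(ν (T − t_{φ j}))`
  set V : ℝ → EuclideanSpace ℝ (Fin 3) → EuclideanSpace ℝ (Fin 3) := nsRescale 2 U with hVdef
  have hV2 : V = (2 : ℝ) • stPull ((2 : ℝ) ^ 2) 2 0 (0 : EuclideanSpace ℝ (Fin 3)) U := nsRescale_eq_smul_stPull 2 U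
  have h2 : (0 : ℝ) < 2 := two_pos
  have hμφ0 : Tendsto (fun k => μ (φ k)) atTop (𝓝 0) := hμ0.comp hφ.tendsto_atTop
  -- ### the door class of `V`
  have hdoorV : IsDoorProfile M' V := by
    refine ⟨?_, ?_, ?_, ?_⟩
    · rw [hV2]; exact rate_smul_stPull hTI.hasTypeITimeDecay h2
    · rw [hV2]; exact cont_smul_stPull hTI.continuousOn_uncurry h2
    · rw [hV2]; exact mild_smul_stPull (fun s t hst ht x => hTI.mild_eq_heatExtension hst ht x) h2
    · intro t' ht'
      have h4t : (2 : ℝ) ^ 2 * t' < 0 := by nlinarith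
      have hdivU : VectorCalculus.IsDivFree (U ((2 : ℝ) ^ 2 * t')) := hTI.isDivFree h4t
      have hdiff : Differentiable ℝ (fun y : EuclideanSpace ℝ (Fin 3) => U ((2 : ℝ) ^ 2 * t') ((2 : ℝ) • y)) :=
        ((hTI.contDiff_slice h4t).differentiable (by simp)).comp (differentiable_id.const_smul (2 : ℝ))
      have h := (hdivU.comp_smul (2 : ℝ)).const_smul hdiff (2 : ℝ)
      have e : V t' = fun y => (2 : ℝ) • U ((2 : ℝ) ^ 2 * t') ((2 : ℝ) • y) := by funext y; rfl
      rw [e]; exact h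
  -- ### the origin is a backward singular point of `V`
  have hsingV : IsBackwardSingularPoint V 0 := by
    intro r hr
    rw [hV2, eLpNorm_top_nsZoom h2, Seregin2020.stAffine_zero_zero_apply_zero, hsingU (2 * r) (by positivity)]
    exact ENNReal.mul_top (by simp)
  -- ### the space–time envelope of `U`: a.e. on each `Q(0, 2ᵐ)` along the `L³` limit, then everywhere
  set g : ℝ × EuclideanSpace ℝ (Fin 3) → ℝ := fun z => M / ν / (‖z.2‖ + Real.sqrt (-z.1)) with hg
  have hae_m : ∀ m : ℕ, ∀ᵐ z ∂(volume.restrict (parabolicCylinder ((2 : ℝ) ^ m) (0 : ℝ × EuclideanSpace ℝ (Fin 3)))),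
      ‖uncurry U z‖ ≤ g z := by
    intro m
    set r : ℝ := (2 : ℝ) ^ m with hr
    have hr0 : 0 < r := by positivity
    -- the tail where the zoom at scale `μ (φ k)` sees only the Type-I cylinder
    have hev : ∀ᶠ k in atTop, μ (φ k) * r < 1 ∧ (μ (φ k)) ^ 2 * (β * r ^ 2) < min T (ρ ^ 2) ∧
        μ (φ k) * (R * r) < ρ := by
      have ha : Tendsto (fun k => μ (φ k) * r) atTop (𝓝 0) := by simpa using hμφ0.mul_const r
      have hb : Tendsto (fun k => (μ (φ k)) ^ 2 * (β * r ^ 2)) atTop (𝓝 0) := by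
        simpa using (hμφ0.pow 2).mul_const (β * r ^ 2)
      have hc' : Tendsto (fun k => μ (φ k) * (R * r)) atTop (𝓝 0) := by simpa using hμφ0.mul_const (R * r)
      exact ((ha.eventually (gt_mem_nhds one_pos)).and
        ((hb.eventually (gt_mem_nhds (lt_min hT (pow_pos hρ 2)))).and
          (hc'.eventually (gt_mem_nhds hρ))))
    obtain ⟨K, hK⟩ := eventually_atTop.1 hev
    set W : ℕ → ℝ → EuclideanSpace ℝ (Fin 3) → EuclideanSpace ℝ (Fin 3) := fun k =>
      μ (φ (k + K)) • stPull (μ (φ (k + K)) ^ 2) (μ (φ (k + K))) (0 : ℝ × EuclideanSpace ℝ (Fin 3)).1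
        (0 : ℝ × EuclideanSpace ℝ (Fin 3)).2 (v (φ (k + K))) with hW
    -- pointwise form of the zooms
    have hWpt : ∀ k s' y', W k s' y' = (μ (φ (k + K)) * α) •
        u (φ (k + K)) (T + β * (μ (φ (k + K)) ^ 2 * s')) (x (φ (k + K)) + R • (μ (φ (k + K)) • y')) := by
      intro k s' y'
      simp only [hW, hv, smul_stPull_apply, Prod.fst_zero, Prod.snd_zero, zero_add, smul_smul]
    -- continuity of the zooms on `Q(0, r)` (they see `Q(0,1)` of `v`) and the pointwise majorant
    have hWc : ∀ k, ContinuousOn (uncurry (W k)) (parabolicCylinder r (0 : ℝ × EuclideanSpace ℝ (Fin 3))) := by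
      intro k
      obtain ⟨hk1, -, -⟩ := hK (k + K) (Nat.le_add_left K k)
      have e : uncurry (W k) = fun w => μ (φ (k + K)) • (uncurry (v (φ (k + K))) ∘
          stAffine (μ (φ (k + K)) ^ 2) (μ (φ (k + K))) (0 : ℝ) (0 : EuclideanSpace ℝ (Fin 3))) w := by
        funext w; rfl
      rw [e]
      exact ContinuousOn.const_smul ((hcontv (φ (k + K))).comp (continuous_stAffine _ _ _ _).continuousOn
        (stAffine_mapsTo_unit (hμpos _) hk1)) (μ (φ (k + K)))
    have hbdW : ∀ k, ∀ z ∈ parabolicCylinder r (0 : ℝ × EuclideanSpace ℝ (Fin 3)), ‖uncurry (W k) z‖ ≤ g z := by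
      intro k z hz
      obtain ⟨-, hk2, hk3⟩ := hK (k + K) (Nat.le_add_left K k)
      have hWz : uncurry (W k) z = (μ (φ (k + K)) * α) •
          u (φ (k + K)) (T + β * (μ (φ (k + K)) ^ 2 * z.1)) (x (φ (k + K)) + R • (μ (φ (k + K)) • z.2)) :=
        hWpt k z.1 z.2
      rw [hWz, hg]
      exact norm_zoom_le_envelope hν hR hβ (hμpos _) hαeq hνβ (hM' (φ (k + K))) hk2 hk3 hz
    -- the a.e. transfer along the `L³` limit
    have hQslab : parabolicCylinder r (0 : ℝ × EuclideanSpace ℝ (Fin 3)) ⊆ Iio (0 : ℝ) ×ˢ univ :=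
      parabolicCylinder_origin_subset_slab r
    have hUm : AEStronglyMeasurable (uncurry U) (volume.restrict (parabolicCylinder r (0 : ℝ × EuclideanSpace ℝ (Fin 3)))) :=
      (hTI.continuousOn_uncurry.mono hQslab).aestronglyMeasurable (isOpen_parabolicCylinder _ _).measurableSet
    have hconvW : Tendsto (fun k => eLpNorm (uncurry (W k) - uncurry U) 3
        (volume.restrict (parabolicCylinder r (0 : ℝ × EuclideanSpace ℝ (Fin 3))))) atTop (𝓝 0) :=
      (hL3 r hr0).comp (tendsto_add_atTop_nat K)
    exact ae_norm_le_of_tendsto_eLpNorm_three (isOpen_parabolicCylinder _ _).measurableSet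
      (fun k => (hWc k).aestronglyMeasurable (isOpen_parabolicCylinder _ _).measurableSet) hUm hconvW
      (Eventually.of_forall hbdW)
  have hdecU : HasTypeIDecay (M / ν) U := by
    -- a.e. on the slab
    have hcover : (Iio (0 : ℝ) ×ˢ (univ : Set (EuclideanSpace ℝ (Fin 3)))) ⊆
        ⋃ m : ℕ, parabolicCylinder ((2 : ℝ) ^ m) (0 : ℝ × EuclideanSpace ℝ (Fin 3)) := by
      rintro ⟨t', y⟩ ⟨ht', -⟩
      have ht'0 : t' < 0 := ht'
      obtain ⟨m, hm⟩ := pow_unbounded_of_one_lt (max (-t') ‖y‖ + 1) (by norm_num : (1 : ℝ) < 2)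
      refine mem_iUnion.2 ⟨m, ?_⟩
      rw [SuitableCompactness.mem_parabolicCylinder_zero]
      have h1 : (1 : ℝ) ≤ (2 : ℝ) ^ m := one_le_pow₀ (by norm_num)
      have h2 : -t' < (2 : ℝ) ^ m := by linarith [le_max_left (-t') ‖y‖]
      have h3 : ‖y‖ < (2 : ℝ) ^ m := by linarith [le_max_right (-t') ‖y‖]
      exact ⟨⟨by nlinarith, ht'0⟩, h3⟩
    have hae : ∀ᵐ z ∂(volume.restrict (Iio (0 : ℝ) ×ˢ (univ : Set (EuclideanSpace ℝ (Fin 3))))),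
        ‖uncurry U z‖ ≤ g z :=
      ae_restrict_of_ae_restrict_of_subset hcover ((ae_restrict_iUnion_iff _ _).2 hae_m)
    -- everywhere, by continuity
    have hUc : ContinuousOn (fun z => ‖uncurry U z‖) (Iio (0 : ℝ) ×ˢ (univ : Set (EuclideanSpace ℝ (Fin 3)))) :=
      hTI.continuousOn_uncurry.norm
    have hgc : ContinuousOn g (Iio (0 : ℝ) ×ˢ (univ : Set (EuclideanSpace ℝ (Fin 3)))) := by
      refine continuousOn_const.div ?_ ?_
      · exact (continuous_snd.norm.add (continuous_fst.neg.sqrt)).continuousOn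
      · rintro ⟨t', y⟩ ⟨ht', -⟩
        have ht'0 : t' < 0 := ht'
        exact (add_pos_of_nonneg_of_pos (norm_nonneg _) (Real.sqrt_pos.2 (by simpa using ht'0))).ne'
    -- everywhere: an open set of measure zero is empty (inlined; the tree's twin lives in a foreign theses cone)
    intro t' ht' y
    by_contra hcon
    set O : Set (ℝ × EuclideanSpace ℝ (Fin 3)) := Iio (0 : ℝ) ×ˢ univ with hO
    have hOo : IsOpen O := isOpen_Iio.prod isOpen_univ
    set S : Set (ℝ × EuclideanSpace ℝ (Fin 3)) := O ∩ (fun w => ‖uncurry U w‖ - g w) ⁻¹' Ioi 0 with hS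
    have hSo : IsOpen S := (hUc.sub hgc).isOpen_inter_preimage hOo isOpen_Ioi
    have hzS : ((t', y) : ℝ × EuclideanSpace ℝ (Fin 3)) ∈ S := by
      refine ⟨⟨ht', mem_univ _⟩, ?_⟩
      show 0 < ‖uncurry U (t', y)‖ - g (t', y)
      have : ¬ ‖U t' y‖ ≤ M / ν / (‖y‖ + Real.sqrt (-t')) := hcon
      simp only [uncurry_apply_pair, hg]
      linarith [not_le.1 this]
    have hpos : 0 < volume S := hSo.measure_pos volume ⟨_, hzS⟩
    have hzero : volume.restrict O {w | ¬ ‖uncurry U w‖ ≤ g w} = 0 := ae_iff.1 hae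
    have h1 : volume.restrict O S = volume S := by
      rw [Measure.restrict_apply hSo.measurableSet, inter_eq_left.2 inter_subset_left]
    have h2 : volume.restrict O S ≤ volume.restrict O {w | ¬ ‖uncurry U w‖ ≤ g w} := by
      refine measure_mono fun w hw => ?_
      have hw' : 0 < ‖uncurry U w‖ - g w := hw.2
      show ¬ ‖uncurry U w‖ ≤ g w
      intro hle
      linarith
    rw [hzero, h1] at h2
    exact absurd (nonpos_iff_eq_zero.1 h2) hpos.ne'
  have hdecV : HasTypeIDecay (M / ν) V := by rw [hVdef]; exact hdecU.nsRescale h2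
  have hdecV' : HasTypeIDecay (max (M / ν) 1) V := fun t' ht' y =>
    (hdecV t' ht' y).trans (div_le_div_of_nonneg_right (le_max_left _ _)
      (add_pos_of_nonneg_of_pos (norm_nonneg _) (Real.sqrt_pos.2 (by linarith))).le)
  refine ⟨φ, M', V, fun j => lam₀ (φ j), hφ, fun j => hlam₀pos (φ j), fun j => ?_, hdoorV, hdecV,
    hfloor M' V hdoorV hdecV' hsingV, fun s hs y => ?_⟩
  · -- `λⱼ² = ν (T − t_{φ j})`
    exact Real.sq_sqrt (mul_pos hν (by linarith [htT (φ j)])).le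
  · -- ### pointwise convergence on `s < −1/4`
    have h4s : 4 * s < -1 := by linarith
    have key := (hpt (4 * s) h4s ((2 : ℝ) • y)).const_smul (2 : ℝ)
    have hVsy : V s y = (2 : ℝ) • U (4 * s) ((2 : ℝ) • y) := by
      show nsRescale 2 U s y = _
      rw [nsRescale_apply]; norm_num
    rw [hVsy]
    refine key.congr fun j => ?_
    simp only [hv, smul_stPull_apply, Prod.fst_zero, Prod.snd_zero, zero_add, smul_smul]
    have hl : lam₀ (φ j) = 2 * R * μ (φ j) := by simp only [hμ]; field_simp
    have e1 : 2 * (μ (φ j) * α) = lam₀ (φ j) / ν := by rw [hl, hαeq]; field_simp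
    have e2 : T + β * (μ (φ j) ^ 2 * (4 * s)) = T + lam₀ (φ j) ^ 2 * s / ν := by rw [hl, hβeq]; field_simp; ring
    have e3 : R * (μ (φ j) * 2) = lam₀ (φ j) := by rw [hl]; ring
    rw [e1, e2, e3]


end Summit.NavierStokesRegularity.NavierStokesRegularity.Theorems.StableStrataDoorAcrossSolutions

end
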